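import Literature.Probability.LatticeModels.TriangularLatticeProofs

/-!
# drefute g2 scratch — the line's row / skew coordinate conventions are consistent with `hexCenter`

Claim checked: for every honeycomb vertex `v = (x, t)` and every family `i : Fin 3`,
`skewCoord i (hexCenter v) = rowCoord i v + (t+1)/3` for `i = 0, 1` and
`skewCoord 2 (hexCenter v) = rowCoord 2 v + (2 - t)/3`… concretely the offsets are
`1/3, 2/3` so the centre lies strictly between the lines `rowCoord i v` and `rowCoord i v + 1`.
(`rowCoord`, `skewCoord` copied verbatim from `Lines/bridge-gate-renewal.lean`.)
-/

noncomputable section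

open Literature.Probability.LatticeModels

namespace DrefuteG2

def rowCoord (i : Fin 3) (v : HexVertex) : ℤ :=
  if i = 0 then v.1 1 else if i = 1 then v.1 0 else v.1 0 + v.1 1 + (v.2 : ℕ)

def skewCoord (i : Fin 3) (z : ℂ) : ℝ :=
  ![2 * z.im / Real.sqrt 3, z.re - z.im / Real.sqrt 3, z.re + z.im / Real.sqrt 3] i

theorem sqrt3_pos : (0 : ℝ) < Real.sqrt 3 := Real.sqrt_pos.mpr (by norm_num)
theorem sqrt3_ne : Real.sqrt 3 ≠ 0 := sqrt3_pos.ne'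

theorem hexCenter_re (v : HexVertex) :
    (hexCenter v).re = (v.1 0 : ℝ) + (v.1 1 : ℝ) / 2 + ((v.2 : ℕ) + 1 : ℝ) / 2 := by
  simp [hexCenter, triEmbed, Complex.add_re, Complex.mul_re, triZeta_re, triZeta_im]
  ring

theorem hexCenter_im (v : HexVertex) :
    (hexCenter v).im = (v.1 1 : ℝ) * (Real.sqrt 3 / 2) + ((v.2 : ℕ) + 1 : ℝ) * (Real.sqrt 3 / 6) := by
  simp [hexCenter, triEmbed, Complex.add_im, Complex.mul_im, triZeta_re, triZeta_im]
  ring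

/-- family 0 (horizontal rows): `skewCoord 0 (hexCenter v) = v.1 1 + (t+1)/3`. -/
theorem skew0 (v : HexVertex) :
    skewCoord 0 (hexCenter v) = (rowCoord 0 v : ℝ) + ((v.2 : ℕ) + 1 : ℝ) / 3 := by
  show 2 * (hexCenter v).im / Real.sqrt 3 = ((if (0 : Fin 3) = 0 then v.1 1 else
    if (0 : Fin 3) = 1 then v.1 0 else v.1 0 + v.1 1 + (v.2 : ℕ) : ℤ) : ℝ) + ((v.2 : ℕ) + 1 : ℝ) / 3
  simp only [Fin.isValue, ↓reduceIte]
  rw [hexCenter_im]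
  have h3 : Real.sqrt 3 ≠ 0 := sqrt3_ne
  field_simp
  ring

/-- family 1 (60° rows): `skewCoord 1 (hexCenter v) = v.1 0 + (t+1)/3`. -/
theorem skew1 (v : HexVertex) :
    skewCoord 1 (hexCenter v) = (rowCoord 1 v : ℝ) + ((v.2 : ℕ) + 1 : ℝ) / 3 := by
  show (hexCenter v).re - (hexCenter v).im / Real.sqrt 3 = ((if (1 : Fin 3) = 0 then v.1 1 else
    if (1 : Fin 3) = 1 then v.1 0 else v.1 0 + v.1 1 + (v.2 : ℕ) : ℤ) : ℝ) + ((v.2 : ℕ) + 1 : ℝ) / 3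
  simp only [Fin.isValue, Fin.reduceEq, ↓reduceIte]
  rw [hexCenter_re, hexCenter_im]
  have h3 : Real.sqrt 3 ≠ 0 := sqrt3_ne
  field_simp
  ring

/-- family 2 (120° rows): `skewCoord 2 (hexCenter v) = (v.1 0 + v.1 1 + t) + (2 - t)·/3`, i.e.
offset `2/3` for up faces and `1/3`… let us just compute: `= v.1 0 + v.1 1 + 2(t+1)/3`. -/
theorem skew2 (v : HexVertex) :
    skewCoord 2 (hexCenter v) = (v.1 0 : ℝ) + (v.1 1 : ℝ) + 2 * ((v.2 : ℕ) + 1 : ℝ) / 3 := by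
  show (hexCenter v).re + (hexCenter v).im / Real.sqrt 3 = _
  rw [hexCenter_re, hexCenter_im]
  have h3 : Real.sqrt 3 ≠ 0 := sqrt3_ne
  field_simp
  ring

/-- Consequence: for both face types the centre lies STRICTLY between the lines numbered
`rowCoord i v` and `rowCoord i v + 1` of family `i` (so `hexBall`/`contHex` are consistent and
every honeycomb edge crosses exactly one line family). -/
theorem skew_mem_Ioo (i : Fin 3) (v : HexVertex) :
    (rowCoord i v : ℝ) < skewCoord i (hexCenter v) ∧
      skewCoord i (hexCenter v) < (rowCoord i v : ℝ) + 1 := by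
  have ht : (v.2 : ℕ) = 0 ∨ (v.2 : ℕ) = 1 := by
    rcases v.2 with ⟨k, hk⟩
    simp only
    omega
  have hcast : ((v.2 : ℕ) : ℝ) = 0 ∨ ((v.2 : ℕ) : ℝ) = 1 := by
    rcases ht with h | h <;> simp [h]
  fin_cases i
  · rw [show ((⟨0, by norm_num⟩ : Fin 3)) = 0 from rfl, skew0]
    rcases hcast with h | h <;> rw [h] <;> constructor <;> linarith
  · rw [show ((⟨1, by norm_num⟩ : Fin 3)) = 1 from rfl, skew1]
    rcases hcast with h | h <;> rw [h] <;> constructor <;> linarith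
  · rw [show ((⟨2, by norm_num⟩ : Fin 3)) = 2 from rfl, skew2]
    have : (rowCoord 2 v : ℝ) = (v.1 0 : ℝ) + (v.1 1 : ℝ) + ((v.2 : ℕ) : ℝ) := by
      simp [rowCoord]
    rw [this]
    rcases hcast with h | h <;> rw [h] <;> constructor <;> linarith

end DrefuteG2

end
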